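import Summits.CriticalPhenomena.PercolationContinuityZ3.Theorems.PercNearOneGluingNoHeavyQuantThetaRussoFormula
import Literature.Probability.Percolation.ClusterBoundary
import Literature.Probability.Percolation.ConstrainedClusters
import Literature.Probability.Percolation.SusceptibilityMeanFieldLower
import Literature.Probability.Percolation.ConnectivityProofs
import HarnessLib

/-!
# QUANT lane (p4 gen 13): Durrett's bound `θ'(p) ≤ θ(p)·E_p[|∂_E C|; |C| < ∞]/(1 − p)` — the pivotal edges of `{0 ↔ ∞}`
# sit on the boundary of the finite cluster, with an infinite cluster outside

builds on p205010 (kernel theorem, internal audit signed; external expert review pending) — NOT used here.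

R. Durrett, *Some general results concerning the critical exponents of percolation processes*, Z. Wahrsch. verw.
Gebiete 69 (1985) 421–437, p. 435, eq. (5): "`0 ≤ ∂M/∂p ≤ (1/(1−p)) M(p) R(p)`", where `R(p) ≤ κ S(p)` is the mean
number of closed boundary edges of the (finite) cluster of the origin whose outer endpoint percolates — obtained there
by differentiating `M = θ` formally ("leaving the justification to the reader") and applying Russo's formula to
`{0 ↔ ∞}`.  This file makes it a theorem on `(p_c, 1)` for `ℤ^d`, `d ≥ 2`, using the seat's Russo formula for the
infinite cluster (`ChiF.hasDerivAt_theta_pivotal`, gen 9): pointwise, if the edge `e = ab` is pivotal for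
`{o ↔ ∞}` then the cluster `S` of `o` in `ω ∖ e` is finite, contains exactly one endpoint, and the other endpoint
percolates OFF `S` (`exists_clusterIs_of_isPivotal_percolatesAt`); the two events are independent
(`bondPercolation_real_inter_of_disjoint`), `P(K_o = S) = (1−p)·P(ω ∖ e ∈ {K_o = S})`, and `P(b ↔ ∞ off S) ≤ θ`.
This file (gen 13) proves the per-edge statement on ANY countable graph:

* `exists_clusterIs_of_isPivotal_percolatesAt` — the pointwise decomposition above;
* `measure_clusterIs_eq_mul` — `P(K_o = S) = P(ω ∖ e ∈ {K_o = S})·(1−p)` for a boundary edge `e` of `S`;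
* `measure_isPivotal_percolatesAt_le` — **`P(e pivotal for {o↔∞}) ≤ [θ_b·Σ_{S∋a,S∌b} P(K_o=S) + θ_a·Σ_{S∋b,S∌a} P(K_o=S)]/(1−p)`**.

The summation over the edges of `ℤ^d` against `ChiF.hasDerivAt_theta_pivotal` — giving Durrett's
`θ'(p) ≤ (θ(p)/(1−p))·Σ_S |∂_E S|·P_p(K = S) ≤ 2dθχ^f/(1−p)` (the last form is the tree's `ChiF.deriv_theta_two_sided`,
obtained there by the Aizenman–Barsky transport) — is left to the next p4 generation (P4-MODULUS census V41′).
HONEST: a REPRODUCTION (rigorous version) of the mechanism of a printed 1985 inequality; no rate at `p_c`.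
-/

noncomputable section

namespace Summit.CriticalPhenomena.PercolationContinuityZ3.Theorems.ThetaPerimeter

open MeasureTheory Literature.Probability.Percolation Literature.Probability.LatticeModels
open scoped ENNReal

variable {V : Type*}

/-! ### §1 Combinatorics of one added edge -/

/-- Reachability in `openGraph η` is membership in `openCluster`. -/
theorem mem_openCluster_iff {η : BondConfig V} {x y : V} : y ∈ openCluster η x ↔ (openGraph η).Reachable x y :=
  Iff.rfl

/-- Adding the edge `ab` to `η`: every vertex joined to `o` in `insert s(a,b) η` is joined to `o` in `η`, or else
one of `a, b` is joined to `o` in `η` and the vertex is joined to `a` or to `b` in `η`. -/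
theorem reachable_insert_cases (η : BondConfig V) (o a b z : V) (h : (openGraph (insert s(a, b) η)).Reachable o z) :
    z ∈ openCluster η o ∨
      ((a ∈ openCluster η o ∨ b ∈ openCluster η o) ∧ (z ∈ openCluster η a ∨ z ∈ openCluster η b)) := by
  rw [SimpleGraph.reachable_iff_reflTransGen] at h
  induction h with
  | refl => exact Or.inl (mem_openCluster_self η o)
  | @tail u v _ huv ih =>
    rw [openGraph_adj] at huv
    obtain ⟨hmem, hne⟩ := huv
    rcases Set.mem_insert_iff.1 hmem with heq | hη
    · -- the step uses the new edge: `{u,v} = {a,b}`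
      have huv' : (u = a ∧ v = b) ∨ (u = b ∧ v = a) := Sym2.eq_iff.1 heq
      have hv : v ∈ openCluster η a ∨ v ∈ openCluster η b := by
        rcases huv' with ⟨_, rfl⟩ | ⟨_, rfl⟩
        · exact Or.inr (mem_openCluster_self η _)
        · exact Or.inl (mem_openCluster_self η _)
      have hu : u = a ∨ u = b := by
        rcases huv' with ⟨h1, _⟩ | ⟨h1, _⟩
        · exact Or.inl h1
        · exact Or.inr h1
      rcases ih with hu0 | ⟨hab, _⟩
      · refine Or.inr ⟨?_, hv⟩
        rcases hu with rfl | rfl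
        · exact Or.inl hu0
        · exact Or.inr hu0
      · exact Or.inr ⟨hab, hv⟩
    · -- the step uses an edge of `η`
      have hadj : (openGraph η).Adj u v := (openGraph_adj η u v).2 ⟨hη, hne⟩
      have ext : ∀ w, u ∈ openCluster η w → v ∈ openCluster η w :=
        fun w hu => SimpleGraph.Reachable.trans hu hadj.reachable
      rcases ih with hu0 | ⟨hab, huab⟩
      · exact Or.inl (ext o hu0)
      · refine Or.inr ⟨hab, ?_⟩
        rcases huab with h1 | h1
        · exact Or.inl (ext a h1)
        · exact Or.inr (ext b h1)

/-- A cluster disjoint from `S` is a cluster of the configuration restricted to the pairs off `S`. -/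
theorem reachable_inter_sym2_compl {η : BondConfig V} {S : Set V} {b z : V}
    (hdisj : ∀ w, w ∈ openCluster η b → w ∉ S) (h : (openGraph η).Reachable b z) :
    (openGraph (η ∩ Sᶜ.sym2)).Reachable b z := by
  rw [SimpleGraph.reachable_iff_reflTransGen] at h
  induction h with
  | refl => exact SimpleGraph.Reachable.refl _
  | @tail u v hu huv ih =>
    rw [openGraph_adj] at huv
    have hu' : u ∈ openCluster η b := (SimpleGraph.reachable_iff_reflTransGen _ _).2 hu
    have hv' : v ∈ openCluster η b :=
      SimpleGraph.Reachable.trans hu' ((openGraph_adj η u v).2 huv).reachable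
    refine ih.trans (SimpleGraph.Adj.reachable ?_)
    rw [openGraph_adj]
    exact ⟨⟨huv.1, Set.mk_mem_sym2_iff.2 ⟨hdisj u hu', hdisj v hv'⟩⟩, huv.2⟩

/-! ### §2 The pointwise decomposition of a pivotal edge of `{o ↔ ∞}` -/

/-- Core of the decomposition: if the cluster of `o` in `η` is finite and contains `x`, while the cluster of `o` in
`insert s(x,y) η` is infinite, then `y` is outside the finite cluster and has an infinite cluster in `η` restricted to
the pairs off that cluster. -/
theorem notMem_and_infinite_of_insert {η : BondConfig V} {o x y : V} (hfin : (openCluster η o).Finite)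
    (hinf : (openCluster (insert s(x, y) η) o).Infinite) (hx : x ∈ openCluster η o) :
    y ∉ openCluster η o ∧ (openCluster (η ∩ ((openCluster η o)ᶜ).sym2) y).Infinite := by
  have hcases := fun z (hz : z ∈ openCluster (insert s(x, y) η) o) => reachable_insert_cases η o x y z hz
  -- from `x ∈ C⁻`: the cluster of `x` in `η` is inside `C⁻`
  have hxa : ∀ w, w ∈ openCluster η x → w ∈ openCluster η o := fun w hw => SimpleGraph.Reachable.trans hx hw
  -- a vertex of the infinite cluster outside the finite one
  obtain ⟨z, hzplus, hzminus⟩ : ∃ z, z ∈ openCluster (insert s(x, y) η) o ∧ z ∉ openCluster η o := by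
    by_contra hcon
    push Not at hcon
    exact hinf (hfin.subset fun z hz => hcon z hz)
  have hy : y ∉ openCluster η o := by
    intro hyo
    rcases hcases z hzplus with h1 | ⟨_, h2 | h2⟩
    · exact hzminus h1
    · exact hzminus (hxa z h2)
    · exact hzminus (SimpleGraph.Reachable.trans hyo h2)
  refine ⟨hy, ?_⟩
  -- `C⁺ ∖ C⁻ ⊆ C_η(y)`, hence `C_η(y)` is infinite
  have hsub : openCluster (insert s(x, y) η) o \ openCluster η o ⊆ openCluster η y := by
    rintro w ⟨hw, hwn⟩
    rcases hcases w hw with h1 | ⟨_, h2 | h2⟩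
    · exact absurd h1 hwn
    · exact absurd (hxa w h2) hwn
    · exact h2
  have hinfy : (openCluster η y).Infinite := (hinf.sdiff hfin).mono hsub
  -- `C_η(y)` avoids `C⁻`, so it is a cluster of the restricted configuration
  have hdisj : ∀ w, w ∈ openCluster η y → w ∉ openCluster η o := by
    intro w hw hwo
    exact hy (SimpleGraph.Reachable.trans hwo (SimpleGraph.Reachable.symm hw))
  exact hinfy.mono fun w hw => reachable_inter_sym2_compl hdisj hw

/-- **If `e = ab` is pivotal for `{o ↔ ∞}` in `ω`**, then the cluster `S` of `o` in `ω ∖ e` is finite, contains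
exactly one endpoint of `e`, and the other endpoint has an infinite cluster in the configuration restricted to the
pairs off `S` (which does not contain `e`). -/
theorem exists_clusterIs_of_isPivotal_percolatesAt {o a b : V} {ω : BondConfig V}
    (h : IsPivotal (percolatesAt o) s(a, b) ω) :
    ∃ S : Finset V, ω \ {s(a, b)} ∈ clusterIs o S ∧
      ((a ∈ S ∧ b ∉ S ∧ (openCluster (ω ∩ ((↑S : Set V)ᶜ).sym2) b).Infinite) ∨
       (b ∈ S ∧ a ∉ S ∧ (openCluster (ω ∩ ((↑S : Set V)ᶜ).sym2) a).Infinite)) := by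
  classical
  rw [isPivotal_iff_of_isUpperSet (isUpperSet_percolatesAt o)] at h
  obtain ⟨hplus, hminus⟩ := h
  set η : BondConfig V := ω \ {s(a, b)} with hη
  have hfin : (openCluster η o).Finite := Set.not_infinite.1 hminus
  have hins : insert s(a, b) ω = insert s(a, b) η := by rw [hη, Set.insert_sdiff_singleton]
  rw [hins] at hplus
  have hinf : (openCluster (insert s(a, b) η) o).Infinite := hplus
  set S : Finset V := hfin.toFinset with hS
  have hSc : (↑S : Set V) = openCluster η o := by rw [hS, Set.Finite.coe_toFinset]
  have hcl : η ∈ clusterIs o S := by rw [mem_clusterIs, hSc]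
  refine ⟨S, hcl, ?_⟩
  -- restriction: `η ∩ (Sᶜ)² = ω ∩ (Sᶜ)²` because `e ∉ (Sᶜ)²` as soon as one endpoint lies in `S`
  have hrestr : s(a, b) ∉ ((↑S : Set V)ᶜ).sym2 → η ∩ ((↑S : Set V)ᶜ).sym2 = ω ∩ ((↑S : Set V)ᶜ).sym2 := by
    intro he
    ext f
    simp only [hη, Set.mem_inter_iff, Set.mem_sdiff, Set.mem_singleton_iff]
    constructor
    · rintro ⟨⟨hf, _⟩, hK⟩; exact ⟨hf, hK⟩
    · rintro ⟨hf, hK⟩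
      exact ⟨⟨hf, fun hfe => he (hfe ▸ hK)⟩, hK⟩
  -- one endpoint is in the finite cluster
  obtain ⟨z, hzplus, hzminus⟩ : ∃ z, z ∈ openCluster (insert s(a, b) η) o ∧ z ∉ openCluster η o := by
    by_contra hcon
    push Not at hcon
    exact hinf (hfin.subset fun z hz => hcon z hz)
  have hab : a ∈ openCluster η o ∨ b ∈ openCluster η o := by
    rcases reachable_insert_cases η o a b z hzplus with h1 | ⟨h2, _⟩
    · exact absurd h1 hzminus
    · exact h2
  rcases hab with ha | hb
  · obtain ⟨hbn, hinfb⟩ := notMem_and_infinite_of_insert hfin hinf ha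
    left
    refine ⟨by rw [← Finset.mem_coe, hSc]; exact ha, by rw [← Finset.mem_coe, hSc]; exact hbn, ?_⟩
    have he : s(a, b) ∉ ((↑S : Set V)ᶜ).sym2 := fun hK =>
      (Set.mk_mem_sym2_iff.1 hK).1 (by rw [hSc]; exact ha)
    rw [← hrestr he, hSc]
    exact hinfb
  · have hinf' : (openCluster (insert s(b, a) η) o).Infinite := by rw [Sym2.eq_swap]; exact hinf
    obtain ⟨han, hinfa⟩ := notMem_and_infinite_of_insert hfin hinf' hb
    right
    refine ⟨by rw [← Finset.mem_coe, hSc]; exact hb, by rw [← Finset.mem_coe, hSc]; exact han, ?_⟩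
    have he : s(a, b) ∉ ((↑S : Set V)ᶜ).sym2 := fun hK =>
      (Set.mk_mem_sym2_iff.1 hK).2 (by rw [hSc]; exact hb)
    rw [← hrestr he, hSc]
    exact hinfa

/-! ### §3 The probability of a pivotal edge of `{o ↔ ∞}` (any countable graph) -/

/-- `{ω | ω ∖ e ∈ A}` is determined by any set of pairs determining `A`. -/
theorem determinedBy_sdiff_preimage {A : Set (BondConfig V)} {T : Set (Sym2 V)} (hA : DeterminedBy A T)
    (e : Sym2 V) : DeterminedBy {ω : BondConfig V | ω \ {e} ∈ A} T := by
  rw [determinedBy_iff] at hA ⊢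
  intro ω ω' h
  simp only [Set.mem_setOf_eq]
  refine hA _ _ ?_
  rw [Set.sdiff_eq, Set.sdiff_eq, Set.inter_right_comm, h, Set.inter_right_comm]

/-- The event "`y` percolates off `S`" is determined by the pairs off `S`. -/
theorem determinedBy_offPerc (S : Set V) (y : V) :
    DeterminedBy {ω : BondConfig V | (openCluster (ω ∩ Sᶜ.sym2) y).Infinite} (Sᶜ.sym2) := by
  rw [determinedBy_iff]
  intro ω ω' h
  simp only [Set.mem_setOf_eq, h]

/-- `{ω | ω ∖ e ∈ A}` is measurable for measurable `A`. -/
theorem measurableSet_sdiff_preimage {A : Set (BondConfig V)} (hA : MeasurableSet A) (e : Sym2 V) :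
    MeasurableSet {ω : BondConfig V | ω \ {e} ∈ A} := by
  have : (fun ω : BondConfig V => ω \ {e}) = fun ω => ω ∩ {e}ᶜ := by funext ω; rw [Set.sdiff_eq]
  have hm : Measurable fun ω : BondConfig V => ω \ {e} := by rw [this]; exact measurable_inter_const _
  exact hA.preimage hm

section Prob

variable [Countable V] (G : SimpleGraph V) (p : unitInterval)

/-- The event "`y` percolates off `S`" (infinite cluster of `y` among the pairs avoiding `S`) is measurable. -/
theorem measurableSet_offPerc (S : Set V) (y : V) :
    MeasurableSet {ω : BondConfig V | (openCluster (ω ∩ Sᶜ.sym2) y).Infinite} :=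
  (measurableSet_percolatesAt_holds y).preimage (measurable_inter_const _)

/-- If exactly one endpoint of `e = xy` lies in `S` then `{K_o = S} ⊆ {e closed}`, so
`P(K_o = S) = P(ω ∖ e ∈ {K_o = S})·(1 − p)` for an edge `e` of `G`. -/
theorem measure_clusterIs_eq_mul (o : V) {x y : V} (S : Finset V) (hx : x ∈ S) (hy : y ∉ S)
    (he : s(x, y) ∈ G.edgeSet) :
    bondPercolation G p (clusterIs o S)
      = bondPercolation G p {ω | ω \ {s(x, y)} ∈ clusterIs o S} * ENNReal.ofReal (1 - p) := by
  have hxy : x ≠ y := fun h => hy (h ▸ hx)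
  have hset : clusterIs o S = {ω : BondConfig V | ω \ {s(x, y)} ∈ clusterIs o S} ∩ {ω | s(x, y) ∉ ω} := by
    ext ω
    simp only [Set.mem_inter_iff, Set.mem_setOf_eq]
    constructor
    · intro hω
      have hcl : s(x, y) ∉ ω := by
        intro hmem
        rw [mem_clusterIs] at hω
        have hxC : x ∈ openCluster ω o := by rw [hω]; exact_mod_cast hx
        have hyC : y ∈ openCluster ω o :=
          SimpleGraph.Reachable.trans hxC ((openGraph_adj ω x y).2 ⟨hmem, hxy⟩).reachable
        rw [hω] at hyC
        exact hy (by exact_mod_cast hyC)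
      refine ⟨?_, hcl⟩
      rwa [Set.sdiff_singleton_eq_self hcl]
    · rintro ⟨h1, h2⟩
      rwa [Set.sdiff_singleton_eq_self h2] at h1
  -- (the two `DeterminedBy` facts below also exist in the tree as
  -- `FitznerVanDerHofstad2017.determinedBy_sdiff_singleton_mem` / `BalancedDeletion.Switching.determinedBy_setOf_notMem`,
  -- in modules too heavy to import here; they are re-derived inline)
  have hdet1 : DeterminedBy {ω : BondConfig V | ω \ {s(x, y)} ∈ clusterIs o S} ({s(x, y)}ᶜ : Set (Sym2 V)) := by
    rw [determinedBy_iff]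
    intro ω ω' h
    simp only [Set.mem_setOf_eq]
    rw [Set.sdiff_eq, Set.sdiff_eq, h]
  have hdet2 : DeterminedBy {ω : BondConfig V | s(x, y) ∉ ω} ({s(x, y)} : Set (Sym2 V)) := by
    rw [determinedBy_iff]
    intro ω ω' h
    simp only [Set.mem_setOf_eq]
    have h1 : s(x, y) ∈ ω ↔ s(x, y) ∈ ω' := by
      have := Set.ext_iff.1 h s(x, y)
      simpa using this
    rw [h1]
  have hind := bondPercolation_inter_of_disjoint G p
    (disjoint_compl_left : Disjoint ({s(x, y)}ᶜ : Set (Sym2 V)) {s(x, y)})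
    hdet1 hdet2 (measurableSet_sdiff_preimage (measurableSet_clusterIs o S) _) (measurableSet_mem (s(x, y))).compl
  have hcl : bondPercolation G p {ω : BondConfig V | s(x, y) ∉ ω} = ENNReal.ofReal (1 - p) := by
    rw [← ofReal_measureReal (measure_ne_top _ _), DCT16.real_notMem G p he]
  calc bondPercolation G p (clusterIs o S)
      = bondPercolation G p ({ω : BondConfig V | ω \ {s(x, y)} ∈ clusterIs o S} ∩ {ω | s(x, y) ∉ ω}) := by
        rw [← hset]
    _ = _ := by rw [hind, hcl]

/-- **Durrett's bound, per edge, on any countable graph**: for an edge `e = ab` of `G` and `p < 1`,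
`P_p(e pivotal for {o ↔ ∞}) ≤ (1/(1−p)) · [θ_b·Σ_{S ∋ a, S ∌ b} P_p(K_o = S) + θ_a·Σ_{S ∋ b, S ∌ a} P_p(K_o = S)]`
(Durrett 1985, p. 435, the two displays before (5): Russo + "P(y → ∞ | C_0 = A) ≤ P(y → ∞) by Harris"; here by
independence of `{ω ∖ e ∈ {K_o = S}}` and "`y` percolates off `S`"). -/
theorem measure_isPivotal_percolatesAt_le [DecidableEq V] (o : V) {a b : V} (he : s(a, b) ∈ G.edgeSet)
    (hp1 : (p : ℝ) < 1) :
    bondPercolation G p {ω | IsPivotal (percolatesAt o) s(a, b) ω}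
      ≤ ((∑' S : Finset V, if a ∈ S ∧ b ∉ S then bondPercolation G p (clusterIs o S) else 0)
            * ENNReal.ofReal (theta G b p)
          + (∑' S : Finset V, if b ∈ S ∧ a ∉ S then bondPercolation G p (clusterIs o S) else 0)
            * ENNReal.ofReal (theta G a p)) / ENNReal.ofReal (1 - p) := by
  set μ := bondPercolation G p with hμ
  set e : Sym2 V := s(a, b) with hedef
  have hq0 : ENNReal.ofReal (1 - (p : ℝ)) ≠ 0 := by
    rw [ENNReal.ofReal_ne_zero_iff]; linarith
  have hqtop : ENNReal.ofReal (1 - (p : ℝ)) ≠ ⊤ := ENNReal.ofReal_ne_top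
  -- the two families of events
  set E1 : Finset V → Set (BondConfig V) := fun S =>
    {ω | (a ∈ S ∧ b ∉ S) ∧ ω \ {e} ∈ clusterIs o S ∧ (openCluster (ω ∩ ((↑S : Set V)ᶜ).sym2) b).Infinite} with hE1
  set E2 : Finset V → Set (BondConfig V) := fun S =>
    {ω | (b ∈ S ∧ a ∉ S) ∧ ω \ {e} ∈ clusterIs o S ∧ (openCluster (ω ∩ ((↑S : Set V)ᶜ).sym2) a).Infinite} with hE2
  have hcover : {ω | IsPivotal (percolatesAt o) e ω} ⊆ ⋃ S : Finset V, (E1 S ∪ E2 S) := by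
    intro ω hω
    obtain ⟨S, hcl, h⟩ := exists_clusterIs_of_isPivotal_percolatesAt hω
    refine Set.mem_iUnion.2 ⟨S, ?_⟩
    rcases h with ⟨h1, h2, h3⟩ | ⟨h1, h2, h3⟩
    · exact Or.inl ⟨⟨h1, h2⟩, hcl, h3⟩
    · exact Or.inr ⟨⟨h1, h2⟩, hcl, h3⟩
  -- termwise bounds
  have hterm : ∀ (x y : V) (S : Finset V), s(x, y) = e →
      μ {ω | (x ∈ S ∧ y ∉ S) ∧ ω \ {e} ∈ clusterIs o S ∧ (openCluster (ω ∩ ((↑S : Set V)ᶜ).sym2) y).Infinite}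
        ≤ (if x ∈ S ∧ y ∉ S then μ (clusterIs o S) else 0) * ENNReal.ofReal (theta G y p)
            / ENNReal.ofReal (1 - p) := by
    intro x y S hxy
    by_cases hS : x ∈ S ∧ y ∉ S
    · rw [if_pos hS]
      have hset : {ω : BondConfig V | (x ∈ S ∧ y ∉ S) ∧ ω \ {e} ∈ clusterIs o S ∧
            (openCluster (ω ∩ ((↑S : Set V)ᶜ).sym2) y).Infinite}
          = {ω | ω \ {e} ∈ clusterIs o S} ∩ {ω | (openCluster (ω ∩ ((↑S : Set V)ᶜ).sym2) y).Infinite} := by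
        ext ω; simp [hS]
      rw [hset, bondPercolation_inter_of_disjoint G p (disjoint_edgesTouching_compl_sym2 (↑S : Set V))
        (determinedBy_sdiff_preimage (determinedBy_clusterIs o S) e) (determinedBy_offPerc _ y)
        (measurableSet_sdiff_preimage (measurableSet_clusterIs o S) e) (measurableSet_offPerc _ y)]
      -- `μ(A) = μ(K_o = S)/(1-p)` and `μ(off-percolation) ≤ θ_y`
      have hA : μ {ω | ω \ {e} ∈ clusterIs o S} = μ (clusterIs o S) / ENNReal.ofReal (1 - p) := by
        rw [ENNReal.eq_div_iff hq0 hqtop, mul_comm]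
        exact (measure_clusterIs_eq_mul G p o S hS.1 hS.2 (hxy ▸ he) |>.trans (by rw [hxy])).symm
      have hoff : μ {ω | (openCluster (ω ∩ ((↑S : Set V)ᶜ).sym2) y).Infinite} ≤ ENNReal.ofReal (theta G y p) := by
        rw [theta, ofReal_measureReal (measure_ne_top _ _)]
        exact measure_mono fun ω hω => Set.Infinite.mono (openCluster_mono Set.inter_subset_left y) hω
      rw [hA]
      calc μ (clusterIs o S) / ENNReal.ofReal (1 - p) * μ {ω | (openCluster (ω ∩ ((↑S : Set V)ᶜ).sym2) y).Infinite}
          ≤ μ (clusterIs o S) / ENNReal.ofReal (1 - p) * ENNReal.ofReal (theta G y p) := by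
            gcongr
        _ = μ (clusterIs o S) * ENNReal.ofReal (theta G y p) / ENNReal.ofReal (1 - p) := by
            rw [ENNReal.div_eq_inv_mul, ENNReal.div_eq_inv_mul, mul_assoc]
    · have hset : {ω : BondConfig V | (x ∈ S ∧ y ∉ S) ∧ ω \ {e} ∈ clusterIs o S ∧
            (openCluster (ω ∩ ((↑S : Set V)ᶜ).sym2) y).Infinite} = ∅ := by
        ext ω; simp [hS]
      rw [hset, measure_empty]; exact bot_le
  calc μ {ω | IsPivotal (percolatesAt o) e ω}
      ≤ μ (⋃ S : Finset V, (E1 S ∪ E2 S)) := measure_mono hcover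
    _ ≤ ∑' S : Finset V, μ (E1 S ∪ E2 S) := measure_iUnion_le _
    _ ≤ ∑' S : Finset V, (μ (E1 S) + μ (E2 S)) := ENNReal.tsum_le_tsum fun S => measure_union_le _ _
    _ = (∑' S, μ (E1 S)) + ∑' S, μ (E2 S) := ENNReal.tsum_add
    _ ≤ (∑' S : Finset V, (if a ∈ S ∧ b ∉ S then μ (clusterIs o S) else 0) * ENNReal.ofReal (theta G b p)
            / ENNReal.ofReal (1 - p))
        + ∑' S : Finset V, (if b ∈ S ∧ a ∉ S then μ (clusterIs o S) else 0) * ENNReal.ofReal (theta G a p)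
            / ENNReal.ofReal (1 - p) := by
        gcongr with S S
        · exact hterm a b S rfl
        · exact hterm b a S Sym2.eq_swap
    _ = _ := by
        have h1 : ∑' S : Finset V, (if a ∈ S ∧ b ∉ S then μ (clusterIs o S) else 0) * ENNReal.ofReal (theta G b p)
              / ENNReal.ofReal (1 - p)
            = (∑' S : Finset V, if a ∈ S ∧ b ∉ S then μ (clusterIs o S) else 0) * ENNReal.ofReal (theta G b p)
              / ENNReal.ofReal (1 - p) := by
          simp only [div_eq_mul_inv, ENNReal.tsum_mul_right]
        have h2 : ∑' S : Finset V, (if b ∈ S ∧ a ∉ S then μ (clusterIs o S) else 0) * ENNReal.ofReal (theta G a p)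
              / ENNReal.ofReal (1 - p)
            = (∑' S : Finset V, if b ∈ S ∧ a ∉ S then μ (clusterIs o S) else 0) * ENNReal.ofReal (theta G a p)
              / ENNReal.ofReal (1 - p) := by
          simp only [div_eq_mul_inv, ENNReal.tsum_mul_right]
        rw [h1, h2, ENNReal.add_div]

end Prob

end Summit.CriticalPhenomena.PercolationContinuityZ3.Theorems.ThetaPerimeter
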